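import Summits.QuantumFields.BalabanUV.Beta.GAN24.SaddlePointBoundInverse

/-!
# `BalabanUV.Beta.GAN24.SaddlePointPerturbation` — binder row G-an2-4 / (CONV-C), road P1-fibre, typer row P1-Y10p (node N15p):
# BREZZI CONSTANTS UNDER PERTURBATION — the hypotheses of `SaddlePointBound.matrix_apriori` for a perturbed saddle-point matrix
# `fromBlocks (H + E) (Bᴴ + E_C) (B + E_B) 0` from those of the unperturbed CLASSICAL one `fromBlocks H Bᴴ B 0`, with explicit constants

NOT IN PRINT; OUR PROOF (of a textbook mechanism).  HONEST FRAMING (cell contract, verbatim): «discharging `BetaPertH` makes Bałaban's UV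
stability UNCONDITIONAL — a real constructive-QFT result; it is NOT the continuum limit and NOT the Clay problem.»  HONEST DEPENDENCY
(verbatim): «continuum YM on T⁴ ⇐ BetaPertH ∧ nine spine estimates (0/9 proved); BetaPertH ⇐ (D1) ∧ (D4) ∧ CAP+tail; G-an2-4 gates asym,
D1 and NE2/3/4.»  [folklore] finite-dimensional linear algebra over an `RCLike` field `𝕜` in EXACTLY the currency of `SaddlePointBound` /
`SaddlePointBoundInverse` (p201186 / p201325, used BY NAME: `norm_le_of_mem_ker_orthogonal`, `bijective`, `isUnit_fromBlocks`,
`inv_entry_bound`); no cited fact, no `def`, no wall binder, no fibre object, nothing of (CONV-C)'s K-slot discharged.  NOT summit progress.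

## Why (typer LEAVES.md v2.4, row P1-Y10p; consumer p1 row L10 `FibreStrip` = shape (I3′))
On the REAL zone the fibre KKT matrix is a classical saddle point `[[T, Bᴴ],[B, 0]]` (`T` coercive on `ker B`, LBB for `B`), so L10a bounds
its inverse.  A Combes–Thomas shift `p ↦ p + iηa` (row Y10c) perturbs every block: `T ↦ T + E` with `re ⟪w, E w⟫ ≥ −δ‖w‖²` where `δ = O(η²)`
(the first-order part of `E` is ANTI-HERMITIAN and costs nothing in the real part of the form — the cosh identity), `B ↦ B + E_B`,
`Bᴴ ↦ Bᴴ + E_C` with `‖E_B‖, ‖E_C‖ = O(η)`, and `Bᴴ + E_C` is NO LONGER the adjoint of `B + E_B`.  This file shows that the FOUR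
hypotheses of the two-kernel engine `matrix_apriori` survive with explicit constants, so the inverse bounds hold on the strip as soon as
`γ′ > 0` — the smallness condition L10 has to meet UNIFORMLY in `j`.

## What is proved (`V, Q` finite-dimensional inner-product spaces over `𝕜`; §5: `Matrix` form with Euclidean norms via `toEuclideanLin`)
§1 bookkeeping: `norm_adjoint_apply_le` (`‖T v‖ ≤ ε‖v‖ ⇒ ‖T† q‖ ≤ ε‖q‖`), `lbb_adjoint_perturb` ((hB′): `(β − ε_B)‖q‖ ≤ ‖(B + E_B)† q‖`),
   `inj_perturb` ((hC′): `(β − ε_C)‖q‖ ≤ ‖(C + E_C) q‖`), `opNorm_perturb` ((hH′): `‖(H + E) v‖ ≤ (η + ε_H)‖v‖`).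
§2 KERNEL TILT `ker_tilt`: for `w′ ∈ ker (B + E_B)`, `‖w′ − P_{ker B} w′‖ ≤ (ε_B/β)‖w′‖` (LBB on `(ker B)ᗮ`); and the test-vector tilt
   `norm_sub_starProjection_ker_le`: `‖w − P_{ker T} w‖ ≤ ‖T w‖/β` for any `T` with LBB constant `β`.
§3 COERCIVITY TRANSFER `kernel_coercivity_perturb` (classical unperturbed data: LBB `β`, coercivity `γ` of `re ⟪w, H w⟫` on `ker B`, `‖H‖ ≤ η`;
   perturbations `‖E‖ ≤ ε_H`, `re ⟪w, E w⟫ ≥ −δ‖w‖²` on `ker B`, `‖E_B‖ ≤ ε_B ≤ β`, `‖E_C‖ ≤ ε_C < β`, `δ ≤ γ`): every `w′ ∈ ker (B + E_B)` has a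
   test vector `z′` with `(Bᴴ + E_C)† z′ = 0`, `‖z′‖ ≤ ‖w′‖` and
   `γ′‖w′‖² ≤ re ⟪z′, (H + E) w′⟫`,  **`γ′ = (γ − δ)(1 − ε_B/β)² − (η + ε_H)(ε_B/β + ε_C/(β − ε_C))`**
   (`z′ := P_{ker (B + E_C†)} P_{ker B} w′`; the two tilts cost `(η + ε_H)·(ε_B/β + ε_C/(β − ε_C))`, the anti-Hermitian part of `E` costs 0).
§4 operator corollary `bijective_perturb`; §5 MATRIX COROLLARIES for `K′ = fromBlocks (H + E) (Bᴴ + E_C) (B + E_B) 0`: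
   `hypotheses_perturb` (the four `matrix_apriori` hypotheses for `K′` with `(γ′, β − ε_B, β − ε_C, η + ε_H)`), **`isUnit_fromBlocks_perturb`**,
   **`inv_entry_bound_perturb`** (the four entrywise blocks of `K′⁻¹` bounded by `γ′⁻¹`, `(β − ε_B)⁻¹(1 + η′/γ′)`, `(β − ε_C)⁻¹(1 + η′/γ′)`,
   `(β − ε_C)⁻¹(β − ε_B)⁻¹η′(1 + η′/γ′)`, `η′ = η + ε_H`), given `0 < γ′`.
-/

open scoped InnerProductSpace
open RCLike

namespace Summit.QuantumFields.BalabanUV.Beta.GAN24.SaddlePointPerturbation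

open SaddlePointBound SaddlePointBoundInverse

variable {𝕜 : Type*} [RCLike 𝕜]
variable {V Q : Type*} [NormedAddCommGroup V] [InnerProductSpace 𝕜 V] [FiniteDimensional 𝕜 V]
  [NormedAddCommGroup Q] [InnerProductSpace 𝕜 Q] [FiniteDimensional 𝕜 Q]

/-! ## §1 Operator-norm bookkeeping: adjoints, and the three scalar hypotheses under perturbation -/

/-- [folklore] The adjoint has the same bound: `‖T v‖ ≤ ε‖v‖` for all `v` gives `‖T† q‖ ≤ ε‖q‖` for all `q`
(`‖T† q‖² = re ⟪q, T T† q⟫ ≤ ‖q‖·ε‖T† q‖`). -/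
theorem norm_adjoint_apply_le (T : V →ₗ[𝕜] Q) {ε : ℝ} (hε : 0 ≤ ε) (hT : ∀ v : V, ‖T v‖ ≤ ε * ‖v‖) (q : Q) :
    ‖LinearMap.adjoint T q‖ ≤ ε * ‖q‖ := by
  have h1 : ‖LinearMap.adjoint T q‖ ^ 2 ≤ ‖q‖ * (ε * ‖LinearMap.adjoint T q‖) := by
    calc ‖LinearMap.adjoint T q‖ ^ 2 = re ⟪LinearMap.adjoint T q, LinearMap.adjoint T q⟫_𝕜 :=
          (inner_self_eq_norm_sq _).symm
      _ = re ⟪q, T (LinearMap.adjoint T q)⟫_𝕜 := by rw [LinearMap.adjoint_inner_left]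
      _ ≤ ‖q‖ * ‖T (LinearMap.adjoint T q)‖ := re_inner_le_norm _ _
      _ ≤ ‖q‖ * (ε * ‖LinearMap.adjoint T q‖) := by gcongr; exact hT _
  by_cases h0 : ‖LinearMap.adjoint T q‖ = 0
  · rw [h0]; positivity
  · have hpos : 0 < ‖LinearMap.adjoint T q‖ := (norm_nonneg _).lt_of_ne (Ne.symm h0)
    rw [sq] at h1
    have h2 : ‖LinearMap.adjoint T q‖ * ‖LinearMap.adjoint T q‖ ≤ (ε * ‖q‖) * ‖LinearMap.adjoint T q‖ := by
      linarith
    exact le_of_mul_le_mul_right h2 hpos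

/-- [folklore] **(hB′)** LBB under perturbation of the constraint rows: `β‖q‖ ≤ ‖B† q‖`, `‖E_B‖ ≤ ε` ⟹ `(β − ε)‖q‖ ≤ ‖(B + E_B)† q‖`. -/
theorem lbb_adjoint_perturb {B E_B : V →ₗ[𝕜] Q} {β ε : ℝ} (hε : 0 ≤ ε)
    (hB : ∀ q : Q, β * ‖q‖ ≤ ‖LinearMap.adjoint B q‖) (hEB : ∀ v : V, ‖E_B v‖ ≤ ε * ‖v‖) (q : Q) :
    (β - ε) * ‖q‖ ≤ ‖LinearMap.adjoint (B + E_B) q‖ := by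
  have h1 := norm_adjoint_apply_le E_B hε hEB q
  have h2 : LinearMap.adjoint (B + E_B) q = LinearMap.adjoint B q + LinearMap.adjoint E_B q := by
    rw [map_add, LinearMap.add_apply]
  have h3 : ‖LinearMap.adjoint B q‖ ≤ ‖LinearMap.adjoint (B + E_B) q‖ + ‖LinearMap.adjoint E_B q‖ := by
    rw [h2]
    calc ‖LinearMap.adjoint B q‖
        = ‖(LinearMap.adjoint B q + LinearMap.adjoint E_B q) - LinearMap.adjoint E_B q‖ := by rw [add_sub_cancel_right]
      _ ≤ ‖LinearMap.adjoint B q + LinearMap.adjoint E_B q‖ + ‖LinearMap.adjoint E_B q‖ := norm_sub_le _ _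
  calc (β - ε) * ‖q‖ = β * ‖q‖ - ε * ‖q‖ := by ring
    _ ≤ ‖LinearMap.adjoint (B + E_B) q‖ := by linarith [hB q]

omit [FiniteDimensional 𝕜 V] [FiniteDimensional 𝕜 Q] in
/-- [folklore] **(hC′)** injectivity-with-constant under perturbation of the multiplier columns:
`β‖q‖ ≤ ‖C q‖`, `‖E_C‖ ≤ ε` ⟹ `(β − ε)‖q‖ ≤ ‖(C + E_C) q‖`. -/
theorem inj_perturb {C E_C : Q →ₗ[𝕜] V} {β ε : ℝ}
    (hC : ∀ q : Q, β * ‖q‖ ≤ ‖C q‖) (hEC : ∀ q : Q, ‖E_C q‖ ≤ ε * ‖q‖) (q : Q) :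
    (β - ε) * ‖q‖ ≤ ‖(C + E_C) q‖ := by
  have h3 : ‖C q‖ ≤ ‖(C + E_C) q‖ + ‖E_C q‖ := by
    rw [LinearMap.add_apply]
    calc ‖C q‖ = ‖(C q + E_C q) - E_C q‖ := by rw [add_sub_cancel_right]
      _ ≤ ‖C q + E_C q‖ + ‖E_C q‖ := norm_sub_le _ _
  calc (β - ε) * ‖q‖ = β * ‖q‖ - ε * ‖q‖ := by ring
    _ ≤ ‖(C + E_C) q‖ := by linarith [hC q, hEC q]

omit [FiniteDimensional 𝕜 V] in
/-- [folklore] **(hH′)** `‖H‖ ≤ η`, `‖E‖ ≤ ε` ⟹ `‖H + E‖ ≤ η + ε`. -/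
theorem opNorm_perturb {H E : V →ₗ[𝕜] V} {η ε : ℝ} (hH : ∀ v : V, ‖H v‖ ≤ η * ‖v‖) (hE : ∀ v : V, ‖E v‖ ≤ ε * ‖v‖)
    (v : V) : ‖(H + E) v‖ ≤ (η + ε) * ‖v‖ := by
  rw [LinearMap.add_apply, add_mul]
  exact (norm_add_le _ _).trans (add_le_add (hH v) (hE v))

/-! ## §2 Kernel tilts -/

omit [FiniteDimensional 𝕜 Q] in
/-- [folklore] **KERNEL TILT**: if `B` is bounded below by `β > 0` on `(ker B)ᗮ` and `‖E_B‖ ≤ ε`, every `w′ ∈ ker (B + E_B)` is within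
`(ε/β)‖w′‖` of its orthogonal projection onto `ker B` (`B (w′ − P w′) = B w′ = −E_B w′`). -/
theorem ker_tilt {B E_B : V →ₗ[𝕜] Q} {β ε : ℝ} (hβ : 0 < β)
    (hB : ∀ x ∈ (LinearMap.ker B)ᗮ, β * ‖x‖ ≤ ‖B x‖) (hEB : ∀ v : V, ‖E_B v‖ ≤ ε * ‖v‖)
    {w' : V} (hw' : w' ∈ LinearMap.ker (B + E_B)) :
    ‖w' - (LinearMap.ker B).starProjection w'‖ ≤ ε / β * ‖w'‖ := by
  set K := LinearMap.ker B with hK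
  have hxK : w' - K.starProjection w' ∈ Kᗮ := Submodule.sub_starProjection_mem_orthogonal (K := K) w'
  have hwK : K.starProjection w' ∈ K := K.starProjection_apply_mem w'
  have hBx : B (w' - K.starProjection w') = -E_B w' := by
    have h0 : B w' + E_B w' = 0 := by
      have := LinearMap.mem_ker.mp hw'
      rwa [LinearMap.add_apply] at this
    rw [map_sub, LinearMap.mem_ker.mp hwK, sub_zero]
    exact eq_neg_of_add_eq_zero_left h0
  have h1 := hB _ hxK
  rw [hBx, norm_neg] at h1
  rw [div_mul_eq_mul_div, le_div_iff₀ hβ]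
  calc ‖w' - K.starProjection w'‖ * β = β * ‖w' - K.starProjection w'‖ := mul_comm _ _
    _ ≤ ‖E_B w'‖ := h1
    _ ≤ ε * ‖w'‖ := hEB w'

/-- [folklore] **TEST-VECTOR TILT**: if `T` satisfies the LBB condition `β‖q‖ ≤ ‖T† q‖` (`β > 0`) then every `w` is within `‖T w‖/β` of its
orthogonal projection onto `ker T`. -/
theorem norm_sub_starProjection_ker_le (T : V →ₗ[𝕜] Q) {β : ℝ} (hβ : 0 < β)
    (hT : ∀ q : Q, β * ‖q‖ ≤ ‖LinearMap.adjoint T q‖) (w : V) :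
    ‖w - (LinearMap.ker T).starProjection w‖ ≤ ‖T w‖ / β := by
  set K := LinearMap.ker T with hK
  have hxK : w - K.starProjection w ∈ Kᗮ := Submodule.sub_starProjection_mem_orthogonal (K := K) w
  have hwK : K.starProjection w ∈ K := K.starProjection_apply_mem w
  have hTx : T (w - K.starProjection w) = T w := by rw [map_sub, LinearMap.mem_ker.mp hwK, sub_zero]
  have h1 := norm_le_of_mem_ker_orthogonal T hT hxK
  rw [hTx] at h1
  rw [le_div_iff₀ hβ, mul_comm]
  exact h1

omit [FiniteDimensional 𝕜 V] [FiniteDimensional 𝕜 Q] in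
/-- [folklore] `re ⟪x, y⟫ ≥ −‖x‖‖y‖`. -/
theorem neg_mul_norm_le_re_inner (x y : V) : -(‖x‖ * ‖y‖) ≤ re ⟪x, y⟫_𝕜 := by
  have h := re_inner_le_norm (𝕜 := 𝕜) x (-y)
  rw [inner_neg_right, map_neg, norm_neg] at h
  linarith

/-! ## §3 Coercivity transfer: the kernel inf-sup of the perturbed two-kernel system -/

/-- [folklore] **COERCIVITY TRANSFER (the kernel inf-sup hypothesis of `SaddlePointBound.apriori` for the perturbed blocks).**
Unperturbed CLASSICAL data: LBB `β‖q‖ ≤ ‖B† q‖` (`β > 0`), coercivity `γ‖w‖² ≤ re ⟪w, H w⟫` on `ker B`, `‖H‖ ≤ η`.  Perturbations: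
`‖E‖ ≤ ε_H` with `re ⟪w, E w⟫ ≥ −δ‖w‖²` on `ker B` (only the Hermitian-negative part of `E` is charged; `δ ≤ γ`), `‖E_B‖ ≤ ε_B ≤ β`,
`‖E_C‖ ≤ ε_C < β`.  Then every `w′ ∈ ker (B + E_B)` admits a test vector `z′` with `(B† + E_C)† z′ = 0`, `‖z′‖ ≤ ‖w′‖` and
`γ′‖w′‖² ≤ re ⟪z′, (H + E) w′⟫`, `γ′ = (γ − δ)(1 − ε_B/β)² − (η + ε_H)(ε_B/β + ε_C/(β − ε_C))`.
Construction: `w := P_{ker B} w′` (tilt `ε_B/β`), `z′ := P_{ker (B + E_C†)} w` (tilt `ε_C/(β − ε_C)`); then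
`re ⟪z′, (H+E) w′⟫ = re ⟪w, H w⟫ + re ⟪w, H(w′−w)⟫ + re ⟪w, E w⟫ + re ⟪w, E(w′−w)⟫ + re ⟪z′−w, (H+E) w′⟫`. -/
theorem kernel_coercivity_perturb {H E : V →ₗ[𝕜] V} {B E_B : V →ₗ[𝕜] Q} {E_C : Q →ₗ[𝕜] V}
    {γ δ β η εH εB εC : ℝ} (hβ : 0 < β) (hη : 0 ≤ η) (hεH : 0 ≤ εH) (hεB : 0 ≤ εB) (hεC : 0 ≤ εC)
    (hεBβ : εB ≤ β) (hεCβ : εC < β) (hδγ : δ ≤ γ)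
    (hB : ∀ q : Q, β * ‖q‖ ≤ ‖LinearMap.adjoint B q‖)
    (hcoer : ∀ w ∈ LinearMap.ker B, γ * ‖w‖ ^ 2 ≤ re ⟪w, H w⟫_𝕜)
    (hH : ∀ v : V, ‖H v‖ ≤ η * ‖v‖)
    (hE : ∀ v : V, ‖E v‖ ≤ εH * ‖v‖)
    (hEre : ∀ w ∈ LinearMap.ker B, -(δ * ‖w‖ ^ 2) ≤ re ⟪w, E w⟫_𝕜)
    (hEB : ∀ v : V, ‖E_B v‖ ≤ εB * ‖v‖)
    (hEC : ∀ q : Q, ‖E_C q‖ ≤ εC * ‖q‖)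
    {w' : V} (hw' : w' ∈ LinearMap.ker (B + E_B)) :
    ∃ z' : V, LinearMap.adjoint (LinearMap.adjoint B + E_C) z' = 0 ∧ ‖z'‖ ≤ ‖w'‖ ∧
      ((γ - δ) * (1 - εB / β) ^ 2 - (η + εH) * (εB / β + εC / (β - εC))) * ‖w'‖ ^ 2
        ≤ re ⟪z', (H + E) w'⟫_𝕜 := by
  -- the unperturbed kernel component `w` of `w'`, and the tilted test vector `z'`
  set K := LinearMap.ker B with hK
  set w := K.starProjection w' with hw
  set T : V →ₗ[𝕜] Q := LinearMap.adjoint (LinearMap.adjoint B + E_C) with hT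
  set z' := (LinearMap.ker T).starProjection w with hz'
  have hwK : w ∈ K := K.starProjection_apply_mem w'
  have hBw : B w = 0 := LinearMap.mem_ker.mp hwK
  have hz'K : z' ∈ LinearMap.ker T := (LinearMap.ker T).starProjection_apply_mem w
  -- (F1)–(F3): the tilt of `ker (B + E_B)` against `ker B`
  have hB' : ∀ x ∈ Kᗮ, β * ‖x‖ ≤ ‖B x‖ := fun x hx => norm_le_of_mem_ker_orthogonal B hB hx
  have F1 : ‖w' - w‖ ≤ εB / β * ‖w'‖ := ker_tilt hβ hB' hEB hw'
  have F2 : ‖w‖ ≤ ‖w'‖ := K.norm_starProjection_apply_le w'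
  have F3 : (1 - εB / β) * ‖w'‖ ≤ ‖w‖ := by
    have h := norm_sub_norm_le w' (w' - w)
    rw [sub_sub_cancel] at h
    linarith
  -- (F4)–(F5): the tilt of the test vector into `ker (B† + E_C)†`
  have hTdef : T = B + LinearMap.adjoint E_C := by
    rw [hT, map_add, LinearMap.adjoint_adjoint]
  have hT' : ∀ q : Q, (β - εC) * ‖q‖ ≤ ‖LinearMap.adjoint T q‖ := by
    intro q
    rw [hT, LinearMap.adjoint_adjoint]
    exact inj_perturb hB hEC q
  have hβC : 0 < β - εC := sub_pos.2 hεCβ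
  have F4 : ‖w - z'‖ ≤ εC / (β - εC) * ‖w‖ := by
    have h1 := norm_sub_starProjection_ker_le T hβC hT' w
    have hTw : T w = LinearMap.adjoint E_C w := by
      rw [hTdef, LinearMap.add_apply, hBw, zero_add]
    have h2 : ‖T w‖ ≤ εC * ‖w‖ := by rw [hTw]; exact norm_adjoint_apply_le E_C hεC hEC w
    calc ‖w - z'‖ ≤ ‖T w‖ / (β - εC) := h1
      _ ≤ εC * ‖w‖ / (β - εC) := div_le_div_of_nonneg_right h2 hβC.le
      _ = εC / (β - εC) * ‖w‖ := by ring
  have F5 : ‖z'‖ ≤ ‖w‖ := (LinearMap.ker T).norm_starProjection_apply_le w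
  refine ⟨z', LinearMap.mem_ker.mp hz'K, F5.trans F2, ?_⟩
  -- the splitting of the form
  have e1 : (H + E) w' = H w + H (w' - w) + (E w + E (w' - w)) := by
    simp only [LinearMap.add_apply, map_sub]
    abel
  have e3 : ⟪w, (H + E) w'⟫_𝕜 = ⟪w, H w⟫_𝕜 + ⟪w, H (w' - w)⟫_𝕜 + (⟪w, E w⟫_𝕜 + ⟪w, E (w' - w)⟫_𝕜) := by
    rw [e1, inner_add_right, inner_add_right, inner_add_right]
  have e4 : ⟪z', (H + E) w'⟫_𝕜 = ⟪w, (H + E) w'⟫_𝕜 + ⟪z' - w, (H + E) w'⟫_𝕜 := by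
    rw [← inner_add_left, add_sub_cancel]
  have key : re ⟪z', (H + E) w'⟫_𝕜 = re ⟪w, H w⟫_𝕜 + re ⟪w, H (w' - w)⟫_𝕜 + re ⟪w, E w⟫_𝕜 + re ⟪w, E (w' - w)⟫_𝕜
      + re ⟪z' - w, (H + E) w'⟫_𝕜 := by
    rw [e4, e3]
    simp only [map_add]
    ring
  -- the five lower bounds
  have b1 : γ * ‖w‖ ^ 2 ≤ re ⟪w, H w⟫_𝕜 := hcoer w hwK
  have b2 : -(‖w‖ * ‖H (w' - w)‖) ≤ re ⟪w, H (w' - w)⟫_𝕜 := neg_mul_norm_le_re_inner _ _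
  have b3 : -(δ * ‖w‖ ^ 2) ≤ re ⟪w, E w⟫_𝕜 := hEre w hwK
  have b4 : -(‖w‖ * ‖E (w' - w)‖) ≤ re ⟪w, E (w' - w)⟫_𝕜 := neg_mul_norm_le_re_inner _ _
  have b5 : -(‖z' - w‖ * ‖(H + E) w'‖) ≤ re ⟪z' - w, (H + E) w'⟫_𝕜 := neg_mul_norm_le_re_inner _ _
  -- the norms entering them
  have q2 : ‖w‖ * ‖H (w' - w)‖ ≤ ‖w‖ * (η * (εB / β * ‖w'‖)) := by
    refine mul_le_mul_of_nonneg_left ((hH _).trans ?_) (norm_nonneg _)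
    exact mul_le_mul_of_nonneg_left F1 hη
  have q4 : ‖w‖ * ‖E (w' - w)‖ ≤ ‖w‖ * (εH * (εB / β * ‖w'‖)) := by
    refine mul_le_mul_of_nonneg_left ((hE _).trans ?_) (norm_nonneg _)
    exact mul_le_mul_of_nonneg_left F1 hεH
  have hηε : 0 ≤ η + εH := add_nonneg hη hεH
  have q5 : ‖z' - w‖ * ‖(H + E) w'‖ ≤ (εC / (β - εC) * ‖w‖) * ((η + εH) * ‖w'‖) := by
    have h1 : ‖z' - w‖ ≤ εC / (β - εC) * ‖w‖ := by rw [norm_sub_rev]; exact F4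
    exact mul_le_mul h1 (opNorm_perturb hH hE w') (norm_nonneg _)
      (mul_nonneg (div_nonneg hεC hβC.le) (norm_nonneg _))
  -- bookkeeping with `a = εB/β`, `b = εC/(β − εC)`
  have ha0 : 0 ≤ εB / β := div_nonneg hεB hβ.le
  have ha1 : 0 ≤ 1 - εB / β := by
    rw [sub_nonneg, div_le_one hβ]; exact hεBβ
  have hb0 : 0 ≤ εC / (β - εC) := div_nonneg hεC hβC.le
  have hX : 0 ≤ ‖w'‖ := norm_nonneg _
  have hWn : 0 ≤ ‖w‖ := norm_nonneg _
  have t1 : (γ - δ) * ((1 - εB / β) * ‖w'‖) ^ 2 ≤ (γ - δ) * ‖w‖ ^ 2 :=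
    mul_le_mul_of_nonneg_left (pow_le_pow_left₀ (mul_nonneg ha1 hX) F3 2) (sub_nonneg.2 hδγ)
  have t2 : ‖w‖ * ‖w'‖ ≤ ‖w'‖ ^ 2 := by
    rw [sq]; exact mul_le_mul_of_nonneg_right F2 hX
  have t4 : (η + εH) * (εB / β + εC / (β - εC)) * (‖w‖ * ‖w'‖)
      ≤ (η + εH) * (εB / β + εC / (β - εC)) * ‖w'‖ ^ 2 :=
    mul_le_mul_of_nonneg_left t2 (mul_nonneg hηε (add_nonneg ha0 hb0))
  rw [key]
  nlinarith [b1, b2, b3, b4, b5, q2, q4, q5, t1, t2, t4, ha0, hb0, hX, hWn, hηε]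

/-- [folklore] From the kernel form `C′† z′ = 0` to the orthogonality form `⟪z′, C′ q⟫ = 0` used by `SaddlePointBound.apriori`. -/
theorem inner_eq_zero_of_adjoint_apply_eq_zero {C' : Q →ₗ[𝕜] V} {z' : V} (h : LinearMap.adjoint C' z' = 0) (q : Q) :
    ⟪z', C' q⟫_𝕜 = 0 := by
  rw [← LinearMap.adjoint_inner_left, h, inner_zero_left]

/-! ## §4 Operator corollary: the perturbed block operator is a bijection -/

/-- [folklore] Under the hypotheses of `kernel_coercivity_perturb` and `0 < γ′`, the perturbed saddle-point operator
`(u, p) ↦ ((H + E) u + (B† + E_C) p, (B + E_B) u)` is a linear bijection of `V × Q` (`SaddlePointBound.bijective` with the constants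
`(γ′, β − ε_B, β − ε_C, η + ε_H)`). -/
theorem bijective_perturb {H E : V →ₗ[𝕜] V} {B E_B : V →ₗ[𝕜] Q} {E_C : Q →ₗ[𝕜] V}
    {γ δ β η εH εB εC : ℝ} (hβ : 0 < β) (hη : 0 ≤ η) (hεH : 0 ≤ εH) (hεB : 0 ≤ εB) (hεC : 0 ≤ εC)
    (hεBβ : εB < β) (hεCβ : εC < β) (hδγ : δ ≤ γ)
    (hγ' : 0 < (γ - δ) * (1 - εB / β) ^ 2 - (η + εH) * (εB / β + εC / (β - εC)))
    (hB : ∀ q : Q, β * ‖q‖ ≤ ‖LinearMap.adjoint B q‖)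
    (hcoer : ∀ w ∈ LinearMap.ker B, γ * ‖w‖ ^ 2 ≤ re ⟪w, H w⟫_𝕜)
    (hH : ∀ v : V, ‖H v‖ ≤ η * ‖v‖)
    (hE : ∀ v : V, ‖E v‖ ≤ εH * ‖v‖)
    (hEre : ∀ w ∈ LinearMap.ker B, -(δ * ‖w‖ ^ 2) ≤ re ⟪w, E w⟫_𝕜)
    (hEB : ∀ v : V, ‖E_B v‖ ≤ εB * ‖v‖)
    (hEC : ∀ q : Q, ‖E_C q‖ ≤ εC * ‖q‖) :
    Function.Bijective (((H + E).coprod (LinearMap.adjoint B + E_C)).prod ((B + E_B).coprod (0 : Q →ₗ[𝕜] Q))) := by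
  have hB' : ∀ x ∈ (LinearMap.ker (B + E_B))ᗮ, (β - εB) * ‖x‖ ≤ ‖(B + E_B) x‖ :=
    fun x hx => norm_le_of_mem_ker_orthogonal (B + E_B) (lbb_adjoint_perturb hεB hB hEB) hx
  refine bijective hγ' (sub_pos.2 hεBβ) (sub_pos.2 hεCβ) (add_nonneg hη hεH) hB' (inj_perturb hB hEC) ?_ (opNorm_perturb hH hE)
  intro w' hw'
  obtain ⟨z', hz', hzw, hcoer'⟩ :=
    kernel_coercivity_perturb hβ hη hεH hεB hεC hεBβ.le hεCβ hδγ hB hcoer hH hE hEre hEB hEC hw'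
  exact ⟨z', inner_eq_zero_of_adjoint_apply_eq_zero hz', hzw, hcoer'⟩

/-! ## §5 Matrix form: `K′ = fromBlocks (H + E) (Bᴴ + E_C) (B + E_B) 0`, Euclidean norms via `toEuclideanLin` -/

section MatrixForm

open Matrix WithLp

variable {n m : Type*} [Fintype n] [DecidableEq n] [Fintype m] [DecidableEq m]

/-- [folklore] **THE FOUR HYPOTHESES OF `SaddlePointBound.matrix_apriori` FOR THE PERTURBED MATRIX.**  From the classical data of
`K = fromBlocks H Bᴴ B 0` (LBB `β`, coercivity `γ` on `ker B`, `‖H‖ ≤ η`) and perturbation blocks `E, E_B, E_C` with `‖E‖ ≤ ε_H`,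
`re ⟪w, E w⟫ ≥ −δ‖w‖²` on `ker B`, `‖E_B‖ ≤ ε_B ≤ β`, `‖E_C‖ ≤ ε_C < β`, `δ ≤ γ`: the blocks `(H + E, B + E_B, Bᴴ + E_C)` satisfy
(hB) with `β − ε_B`, (hC) with `β − ε_C`, (hHC) with `γ′ = (γ − δ)(1 − ε_B/β)² − (η + ε_H)(ε_B/β + ε_C/(β − ε_C))`, (hH) with `η + ε_H`. -/
theorem hypotheses_perturb {H E : Matrix n n 𝕜} {B E_B : Matrix m n 𝕜} {E_C : Matrix n m 𝕜}
    {γ δ β η εH εB εC : ℝ} (hβ : 0 < β) (hη : 0 ≤ η) (hεH : 0 ≤ εH) (hεB : 0 ≤ εB) (hεC : 0 ≤ εC)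
    (hεBβ : εB ≤ β) (hεCβ : εC < β) (hδγ : δ ≤ γ)
    (hB : ∀ q : EuclideanSpace 𝕜 m, β * ‖q‖ ≤ ‖toEuclideanLin Bᴴ q‖)
    (hcoer : ∀ w : EuclideanSpace 𝕜 n, toEuclideanLin B w = 0 → γ * ‖w‖ ^ 2 ≤ re ⟪w, toEuclideanLin H w⟫_𝕜)
    (hH : ∀ v : EuclideanSpace 𝕜 n, ‖toEuclideanLin H v‖ ≤ η * ‖v‖)
    (hE : ∀ v : EuclideanSpace 𝕜 n, ‖toEuclideanLin E v‖ ≤ εH * ‖v‖)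
    (hEre : ∀ w : EuclideanSpace 𝕜 n, toEuclideanLin B w = 0 → -(δ * ‖w‖ ^ 2) ≤ re ⟪w, toEuclideanLin E w⟫_𝕜)
    (hEB : ∀ v : EuclideanSpace 𝕜 n, ‖toEuclideanLin E_B v‖ ≤ εB * ‖v‖)
    (hEC : ∀ q : EuclideanSpace 𝕜 m, ‖toEuclideanLin E_C q‖ ≤ εC * ‖q‖) :
    (∀ q : EuclideanSpace 𝕜 m, (β - εB) * ‖q‖ ≤ ‖toEuclideanLin (B + E_B)ᴴ q‖) ∧
    (∀ q : EuclideanSpace 𝕜 m, (β - εC) * ‖q‖ ≤ ‖toEuclideanLin (Bᴴ + E_C) q‖) ∧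
    (∀ w : EuclideanSpace 𝕜 n, toEuclideanLin (B + E_B) w = 0 → ∃ z : EuclideanSpace 𝕜 n,
      toEuclideanLin (Bᴴ + E_C)ᴴ z = 0 ∧ ‖z‖ ≤ ‖w‖ ∧
        ((γ - δ) * (1 - εB / β) ^ 2 - (η + εH) * (εB / β + εC / (β - εC))) * ‖w‖ ^ 2
          ≤ re ⟪z, toEuclideanLin (H + E) w⟫_𝕜) ∧
    (∀ v : EuclideanSpace 𝕜 n, ‖toEuclideanLin (H + E) v‖ ≤ (η + εH) * ‖v‖) := by
  -- dictionary: conjugate transpose = adjoint, sums of matrices = sums of maps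
  have hBadj : ∀ q : EuclideanSpace 𝕜 m, β * ‖q‖ ≤ ‖LinearMap.adjoint (toEuclideanLin B) q‖ := fun q => by
    rw [← Matrix.toEuclideanLin_conjTranspose_eq_adjoint]; exact hB q
  have hcoer' : ∀ w ∈ LinearMap.ker (toEuclideanLin B), γ * ‖w‖ ^ 2 ≤ re ⟪w, toEuclideanLin H w⟫_𝕜 :=
    fun w hw => hcoer w (LinearMap.mem_ker.mp hw)
  have hEre' : ∀ w ∈ LinearMap.ker (toEuclideanLin B), -(δ * ‖w‖ ^ 2) ≤ re ⟪w, toEuclideanLin E w⟫_𝕜 :=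
    fun w hw => hEre w (LinearMap.mem_ker.mp hw)
  have eB : toEuclideanLin (B + E_B) = toEuclideanLin B + toEuclideanLin E_B := map_add _ _ _
  have eC : toEuclideanLin (Bᴴ + E_C) = LinearMap.adjoint (toEuclideanLin B) + toEuclideanLin E_C := by
    rw [map_add, Matrix.toEuclideanLin_conjTranspose_eq_adjoint]
  have eH : toEuclideanLin (H + E) = toEuclideanLin H + toEuclideanLin E := map_add _ _ _
  refine ⟨fun q => ?_, fun q => ?_, fun w hw => ?_, fun v => ?_⟩
  · rw [Matrix.toEuclideanLin_conjTranspose_eq_adjoint, eB]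
    exact lbb_adjoint_perturb hεB hBadj hEB q
  · rw [eC]
    exact inj_perturb hBadj hEC q
  · have hw' : w ∈ LinearMap.ker (toEuclideanLin B + toEuclideanLin E_B) := by
      rw [LinearMap.mem_ker, ← eB]; exact hw
    obtain ⟨z', hz', hzw, hcoer''⟩ :=
      kernel_coercivity_perturb hβ hη hεH hεB hεC hεBβ hεCβ hδγ hBadj hcoer' hH hE hEre' hEB hEC hw'
    refine ⟨z', ?_, hzw, ?_⟩
    · rw [Matrix.toEuclideanLin_conjTranspose_eq_adjoint, eC]; exact hz'
    · rw [eH]; exact hcoer''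
  · rw [eH]; exact opNorm_perturb hH hE v

/-- [folklore] **INVERTIBILITY OF THE PERTURBED SADDLE-POINT MATRIX**: under the hypotheses of `hypotheses_perturb` and
`0 < γ′`, `fromBlocks (H + E) (Bᴴ + E_C) (B + E_B) 0` is invertible (`SaddlePointBound.isUnit_fromBlocks` BY NAME). -/
theorem isUnit_fromBlocks_perturb {H E : Matrix n n 𝕜} {B E_B : Matrix m n 𝕜} {E_C : Matrix n m 𝕜}
    {γ δ β η εH εB εC : ℝ} (hβ : 0 < β) (hη : 0 ≤ η) (hεH : 0 ≤ εH) (hεB : 0 ≤ εB) (hεC : 0 ≤ εC)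
    (hεBβ : εB < β) (hεCβ : εC < β) (hδγ : δ ≤ γ)
    (hγ' : 0 < (γ - δ) * (1 - εB / β) ^ 2 - (η + εH) * (εB / β + εC / (β - εC)))
    (hB : ∀ q : EuclideanSpace 𝕜 m, β * ‖q‖ ≤ ‖toEuclideanLin Bᴴ q‖)
    (hcoer : ∀ w : EuclideanSpace 𝕜 n, toEuclideanLin B w = 0 → γ * ‖w‖ ^ 2 ≤ re ⟪w, toEuclideanLin H w⟫_𝕜)
    (hH : ∀ v : EuclideanSpace 𝕜 n, ‖toEuclideanLin H v‖ ≤ η * ‖v‖)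
    (hE : ∀ v : EuclideanSpace 𝕜 n, ‖toEuclideanLin E v‖ ≤ εH * ‖v‖)
    (hEre : ∀ w : EuclideanSpace 𝕜 n, toEuclideanLin B w = 0 → -(δ * ‖w‖ ^ 2) ≤ re ⟪w, toEuclideanLin E w⟫_𝕜)
    (hEB : ∀ v : EuclideanSpace 𝕜 n, ‖toEuclideanLin E_B v‖ ≤ εB * ‖v‖)
    (hEC : ∀ q : EuclideanSpace 𝕜 m, ‖toEuclideanLin E_C q‖ ≤ εC * ‖q‖) :
    IsUnit (Matrix.fromBlocks (H + E) (Bᴴ + E_C) (B + E_B) 0) := by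
  obtain ⟨h1, h2, h3, h4⟩ := hypotheses_perturb hβ hη hεH hεB hεC hεBβ.le hεCβ hδγ hB hcoer hH hE hEre hEB hEC
  exact isUnit_fromBlocks hγ' (sub_pos.2 hεBβ) (sub_pos.2 hεCβ) (add_nonneg hη hεH) h1 h2 h3 h4

/-- [folklore] **ENTRYWISE BOUNDS FOR THE INVERSE OF THE PERTURBED SADDLE-POINT MATRIX** (`SaddlePointBoundInverse.inv_entry_bound` BY NAME
with the perturbed constants `γ′`, `β − ε_B`, `β − ε_C`, `η′ = η + ε_H`): the four blocks of `(fromBlocks (H + E) (Bᴴ + E_C) (B + E_B) 0)⁻¹`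
are bounded entrywise by `γ′⁻¹`, `(β − ε_B)⁻¹(1 + η′/γ′)`, `(β − ε_C)⁻¹(1 + η′/γ′)`, `(β − ε_C)⁻¹(β − ε_B)⁻¹η′(1 + η′/γ′)`. -/
theorem inv_entry_bound_perturb {H E : Matrix n n 𝕜} {B E_B : Matrix m n 𝕜} {E_C : Matrix n m 𝕜}
    {γ δ β η εH εB εC : ℝ} (hβ : 0 < β) (hη : 0 ≤ η) (hεH : 0 ≤ εH) (hεB : 0 ≤ εB) (hεC : 0 ≤ εC)
    (hεBβ : εB < β) (hεCβ : εC < β) (hδγ : δ ≤ γ)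
    (hγ' : 0 < (γ - δ) * (1 - εB / β) ^ 2 - (η + εH) * (εB / β + εC / (β - εC)))
    (hB : ∀ q : EuclideanSpace 𝕜 m, β * ‖q‖ ≤ ‖toEuclideanLin Bᴴ q‖)
    (hcoer : ∀ w : EuclideanSpace 𝕜 n, toEuclideanLin B w = 0 → γ * ‖w‖ ^ 2 ≤ re ⟪w, toEuclideanLin H w⟫_𝕜)
    (hH : ∀ v : EuclideanSpace 𝕜 n, ‖toEuclideanLin H v‖ ≤ η * ‖v‖)
    (hE : ∀ v : EuclideanSpace 𝕜 n, ‖toEuclideanLin E v‖ ≤ εH * ‖v‖)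
    (hEre : ∀ w : EuclideanSpace 𝕜 n, toEuclideanLin B w = 0 → -(δ * ‖w‖ ^ 2) ≤ re ⟪w, toEuclideanLin E w⟫_𝕜)
    (hEB : ∀ v : EuclideanSpace 𝕜 n, ‖toEuclideanLin E_B v‖ ≤ εB * ‖v‖)
    (hEC : ∀ q : EuclideanSpace 𝕜 m, ‖toEuclideanLin E_C q‖ ≤ εC * ‖q‖) :
    let γ' := (γ - δ) * (1 - εB / β) ^ 2 - (η + εH) * (εB / β + εC / (β - εC))
    let η' := η + εH
    let K' := Matrix.fromBlocks (H + E) (Bᴴ + E_C) (B + E_B) 0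
    (∀ i j : n, ‖K'⁻¹ (Sum.inl i) (Sum.inl j)‖ ≤ γ'⁻¹) ∧
    (∀ (i : n) (l : m), ‖K'⁻¹ (Sum.inl i) (Sum.inr l)‖ ≤ (β - εB)⁻¹ * (1 + η' / γ')) ∧
    (∀ (k : m) (j : n), ‖K'⁻¹ (Sum.inr k) (Sum.inl j)‖ ≤ (β - εC)⁻¹ * (1 + η' / γ')) ∧
    (∀ k l : m, ‖K'⁻¹ (Sum.inr k) (Sum.inr l)‖ ≤ (β - εC)⁻¹ * (β - εB)⁻¹ * η' * (1 + η' / γ')) := by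
  intro γ' η' K'
  obtain ⟨h1, h2, h3, h4⟩ := hypotheses_perturb hβ hη hεH hεB hεC hεBβ.le hεCβ hδγ hB hcoer hH hE hEre hEB hEC
  exact inv_entry_bound hγ' (sub_pos.2 hεBβ) (sub_pos.2 hεCβ) (add_nonneg hη hεH) h1 h2 h3 h4

end MatrixForm

end Summit.QuantumFields.BalabanUV.Beta.GAN24.SaddlePointPerturbation
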